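import Literature.Topology.FourManifolds.LadderCore
import HarnessLib

/-!
# The snake `{q₀ ≤ 0}` is connected: Reeb's argument with a connected set of minima, and the
# explicit spine of the cut ladder

Topic `Literature/Topology/FourManifolds`; brick E1-M(c) of the constructive road (P1′), route M,
to `Literature.Topology.FourManifolds.Trisection.isConnectedSum_of_reducing_separating`
(`ReducibleTrisectionSplitting.lean`, § Status), sequel of `LadderCore.lean`.

* §1 `isConnected_preimage_Iic_of_isCompact_of_subset` (generic): a compact sublevel set
  `{f ≤ a}` of a `C²` function on a manifold without boundary is connected as soon as all its
  critical points of index `0` lie in ONE preconnected subset of `{f ≤ a}` (Reeb's argument,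
  Milnor, *Morse theory* (1963), proof of Thm. 4.1; the one-minimum case is the tree's
  `isConnected_preimage_Iic_of_isCompact`).
* §2 The spine of the snake `{q₀ ≤ 0}` of the core function `q₀ = P.core` of `LadderCore.lean`:
  the cap axis `[-t₀, 0] × {0}`, the lower valley floor `y = -s(x)` (`0 ≤ x ≤ x_R - 1`), and for
  every hole the rung `{ctr i + x₂} × [-s, s]` and the upper valley floor `y = s(x)` from the
  pocket `(4i + 2 - z₁/2, 1)` to the rung.  Along the floors `q ≤ τ x` (`ladderFun_floor_le`,
  by `S(t) ≥ |t|`), along a rung `q ≤ q(·, 0)` (`ladderFun_rung_le`: `∂q/∂y ≤ 0` on `[0, s]` by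
  the slope bound `4 s² m₀ > κ`, and `q` is even in `y`), on the cap axis `q ≤ τ t₀ < 1/8`; with
  `c' > 3/10` every piece lies in `{q₀ ≤ 0}` (`spine_subset`), the spine is preconnected
  (`isPreconnected_spine`) and contains the cap minimum and the `k` pockets, i.e. all critical
  points of index `0` of `q₀` below `0` (`criticalSetOfIndex_core_zero_inter_subset_spine`).
  Hence **`{q₀ ≤ 0}` is connected** (`isConnected_core_preimage`).

Everything is **proved**; no named fact is introduced.

## References
* J. Milnor, *Morse theory*, Ann. of Math. Studies 51 (1963), §3 and proof of Thm. 4.1.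
  [Milnor1963]
-/

noncomputable section

open scoped Topology ContDiff Manifold
open Set Filter Real
open Literature.Analysis.Pluripotential
open Literature.Geometry.Symplectic.LegendrianModel (bump dbump bump_pos bump_eq_zero bump_nonneg
  bump_le_bump_zero bump_lt_bump bump_le_bump dbump_eq_zero contDiff_bump bump_pos_iff bump_neg dbump_neg)

namespace Literature.Topology.FourManifolds

/-- Local notation: `𝔼 n` is the model Euclidean space `EuclideanSpace ℝ (Fin n)`. -/
local notation "𝔼 " n:arg => EuclideanSpace ℝ (Fin n)

/-! ### §1 Reeb's argument with a connected set of minima -/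

section Reeb

variable {n : ℕ} {M : Type*} [TopologicalSpace M] [ChartedSpace (𝔼 (n + 1)) M] [IsManifold (𝓡 (n + 1)) ∞ M]
  {f : M → ℝ} {a : ℝ}

omit [IsManifold (𝓡 (n + 1)) ∞ M] in
/-- **A compact sublevel set `{f ≤ a}` of a `C²` function on a manifold without boundary is
connected as soon as all its critical points of index `0` lie in one preconnected subset of
`{f ≤ a}`** (Reeb's argument, Milnor, *Morse theory* (1963), proof of Thm. 4.1: a closed-open
piece of `{f ≤ a}` carries a minimiser, which is a local minimum, i.e. a critical point of index
`0`; two pieces would then separate the preconnected set).  The case of a single critical point of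
index `0` is `isConnected_preimage_Iic_of_isCompact`. [cite: Milnor1963, §3 and proof of Thm. 4.1] -/
theorem isConnected_preimage_Iic_of_isCompact_of_subset (hf : ContMDiff (𝓡 (n + 1)) 𝓘(ℝ, ℝ) 2 f)
    (hK : IsCompact (f ⁻¹' Iic a)) {S : Set M} (hS : IsPreconnected S) (hSsub : S ⊆ f ⁻¹' Iic a)
    (h0 : criticalSetOfIndex (𝓡 (n + 1)) f 0 ∩ f ⁻¹' Iic a ⊆ S) (hne : (f ⁻¹' Iic a).Nonempty) :
    IsConnected (f ⁻¹' Iic a) := by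
  refine ⟨hne, ?_⟩
  rw [isPreconnected_iff_subset_of_disjoint_closed]
  intro u v hu hv huv hdisj
  by_contra hcon
  rw [not_or] at hcon
  obtain ⟨hSu, hSv⟩ := hcon
  obtain ⟨xv, hxvS, hxvu⟩ := not_subset.1 hSu
  obtain ⟨xu, hxuS, hxuv⟩ := not_subset.1 hSv
  have hxv : xv ∈ v := (huv hxvS).resolve_left hxvu
  have hxu : xu ∈ u := (huv hxuS).resolve_right hxuv
  have key : ∀ (u v : Set M), IsClosed u → IsClosed v → f ⁻¹' Iic a ⊆ u ∪ v →
      f ⁻¹' Iic a ∩ (u ∩ v) = ∅ → (f ⁻¹' Iic a ∩ u).Nonempty →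
      ∃ m ∈ f ⁻¹' Iic a ∩ u, m ∈ criticalSetOfIndex (𝓡 (n + 1)) f 0 := by
    intro u v hu hv huv hdisj hne
    obtain ⟨m, hm, hmin⟩ := (hK.inter_right hu).exists_isMinOn hne hf.continuous.continuousOn
    have hloc : IsLocalMin f m := isLocalMin_of_isMinOn_piece hv huv hdisj hm hmin
    exact ⟨m, hm, IsLocalMin.isMCriticalPt hloc, IsLocalMin.morseIndex_eq_zero (hf m) hloc⟩
  obtain ⟨m, hm, hmc⟩ := key u v hu hv huv hdisj ⟨xu, hxuS, hxu⟩
  obtain ⟨m', hm', hm'c⟩ := key v u hv hu (by rwa [union_comm]) (by rwa [inter_comm v u])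
    ⟨xv, hxvS, hxv⟩
  have hmS : m ∈ S := h0 ⟨hmc, hm.1⟩
  have hm'S : m' ∈ S := h0 ⟨hm'c, hm'.1⟩
  -- the preconnected `S` lies in `u` or in `v`
  have hSuv : S ⊆ u ∪ v := hSsub.trans huv
  have hSdisj : S ∩ (u ∩ v) = ∅ :=
    Set.eq_empty_of_subset_empty ((Set.inter_subset_inter_left _ hSsub).trans hdisj.subset)
  rcases (isPreconnected_iff_subset_of_disjoint_closed.1 hS) u v hu hv hSuv hSdisj with h | h
  · have : m' ∈ f ⁻¹' Iic a ∩ (u ∩ v) := ⟨hm'.1, h hm'S, hm'.2⟩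
    rw [hdisj] at this; exact this
  · have : m ∈ f ⁻¹' Iic a ∩ (u ∩ v) := ⟨hm.1, hm.2, h hmS⟩
    rw [hdisj] at this; exact this

end Reeb

namespace Ladder

open Literature.Analysis.Pluripotential

/-! ### §2 The spine of the snake `{q₀ ≤ 0}` -/

/-- `S` is even. [folklore] -/
theorem smoothAbs_neg (t : ℝ) : smoothAbs (-t) = smoothAbs t := by
  have hd : ∀ x, HasDerivAt (fun t => smoothAbs (-t) - smoothAbs t) 0 x := fun x => by
    have h1 := (hasDerivAt_smoothAbs (-x)).comp x (hasDerivAt_neg x)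
    have h2 : HasDerivAt (fun t => smoothAbs (-t) - smoothAbs t) (smoothSign (-x) * -1 - smoothSign x) x :=
      h1.sub (hasDerivAt_smoothAbs x)
    rw [smoothSign_neg] at h2
    have e : (0 : ℝ) = -smoothSign x * -1 - smoothSign x := by ring
    rw [e]; exact h2
  have hc := is_const_of_deriv_eq_zero (f := fun t => smoothAbs (-t) - smoothAbs t)
    (fun x => (hd x).differentiableAt) (fun x => (hd x).deriv) t 0
  simp only [neg_zero, sub_self] at hc
  linarith

namespace Params

variable {k : ℕ} (P : Params k)

/-- The ladder is even in `y`. [folklore] -/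
theorem ladderFun_neg (x y : ℝ) : P.ladderFun x (-y) = P.ladderFun x y := by
  unfold ladderFun
  rw [show 4 * sFun k x * -y / P.κ = -(4 * sFun k x * y / P.κ) by ring, smoothAbs_neg,
    show -y - 2 = -y - 2 by rfl, show -(-y) - 2 = y - 2 by ring]
  ring

/-- **On the valley floors `y = ± s(x)` the ladder is at most `τ x`** (`0 ≤ x ≤ x_R`):
`2s² - (κ/2) S(4s²/κ) ≤ 0` by `S(t) ≥ |t|`. [folklore] -/
theorem ladderFun_floor_le {x : ℝ} (hx0 : 0 ≤ x) (hxR : x ≤ xR k) : P.ladderFun x (sFun k x) ≤ P.τ * x := by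
  have hκ := P.κ_pos
  have hs0 := sFun_nonneg k x
  have hs1 := sFun_le_one k x
  unfold ladderFun
  rw [barrier_of_nonpos (by linarith : -x ≤ 0), barrier_of_nonpos (by linarith : x - xR k ≤ 0),
    barrier_of_nonpos (by linarith : sFun k x - 2 ≤ 0), barrier_of_nonpos (by linarith : -sFun k x - 2 ≤ 0)]
  have hS := abs_le_smoothAbs (4 * sFun k x * sFun k x / P.κ)
  rw [abs_of_nonneg (by positivity)] at hS
  have : P.κ / 2 * (4 * sFun k x * sFun k x / P.κ) = 2 * sFun k x ^ 2 := by field_simp; ring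
  nlinarith [mul_le_mul_of_nonneg_left hS (by linarith : (0:ℝ) ≤ P.κ / 2)]

/-- The same on the lower floor `y = -s(x)`. [folklore] -/
theorem ladderFun_floor_le' {x : ℝ} (hx0 : 0 ≤ x) (hxR : x ≤ xR k) : P.ladderFun x (-sFun k x) ≤ P.τ * x := by
  rw [P.ladderFun_neg]; exact P.ladderFun_floor_le hx0 hxR

/-- `∂q/∂y` as the derivative of `y ↦ q(x, y)`. [folklore] -/
theorem hasDerivAt_ladderFun_y (x y : ℝ) : HasDerivAt (fun y => P.ladderFun x y) (P.dY x y) y := by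
  have hc : HasDerivAt (fun t : ℝ => pt x t) ((1 : ℝ) • e1) y := by
    have h := ((hasDerivAt_id y).smul_const e1).const_add (pt x 0)
    have hfun : (fun t : ℝ => pt x 0 + id t • e1) = fun t => pt x t := by
      funext t; ext i; fin_cases i <;> simp
    rw [hfun] at h; exact h
  have h := (P.hasFDerivAt_ladder (pt x y)).comp_hasDerivAt y hc
  have hval : P.ladderD (pt x y) ((1 : ℝ) • e1) = P.dY x y := by
    rw [ladderD_apply]; simp [e1]
  rw [hval] at h
  exact h

/-- **`∂q/∂y ≤ 0` on the upper half of a rung** (`0 ≤ y ≤ s(x)`, `1 ≤ x ≤ x_R`): the slope bound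
`4 s² m₀ > κ` again. [folklore] -/
theorem dY_nonpos_rung {x y : ℝ} (hx1 : 1 ≤ x) (hy : y ∈ Icc 0 (sFun k x)) : P.dY x y ≤ 0 := by
  have hκ := P.κ_pos
  have hm := P.m₀_pos
  have hs1 := sFun_le_one k x
  have hs2 : 1 - 2 * bump 0 ≤ sFun k x ^ 2 := uMin_le_sFun_sq hx1
  have hu := uMin_pos
  have hsn := sFun_nonneg k x
  have hs0 : 0 < sFun k x := by
    rcases hsn.eq_or_lt with h | h
    · rw [← h] at hs2; norm_num at hs2; linarith
    · exact h
  set s := sFun k x with hs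
  rw [P.dY_of_abs_le (by rw [abs_of_nonneg hy.1]; linarith [hy.2])]
  set t := 4 * s * y / P.κ with ht
  have ht0 : 0 ≤ t := by
    rw [ht]; exact div_nonneg (mul_nonneg (mul_nonneg (by norm_num) hs0.le) hy.1) hκ.le
  rcases le_or_gt 1 t with h1 | h1
  · rw [smoothSign_of_one_le h1]; linarith [hy.2]
  · have hσ : P.m₀ * t ≤ smoothSign t := P.m₀_slope t ⟨ht0, h1.le⟩
    have hbig : 1 < 4 * s ^ 2 / P.κ * P.m₀ := by
      rw [div_mul_eq_mul_div, one_lt_div hκ]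
      calc P.κ < 4 * (1 - 2 * bump 0) * P.m₀ := P.κ_lt
        _ ≤ 4 * s ^ 2 * P.m₀ := by gcongr
    have e : 2 * s * (P.m₀ * t) = 2 * y * (4 * s ^ 2 / P.κ * P.m₀) := by rw [ht]; field_simp
    have h2 : 2 * s * (P.m₀ * t) ≤ 2 * s * smoothSign t := mul_le_mul_of_nonneg_left hσ (by linarith)
    nlinarith [hy.1]

/-- **Along a rung the ladder is at most its value on the axis**: `q(x, y) ≤ q(x, 0)` for
`|y| ≤ s(x)`, `1 ≤ x`. [folklore] -/
theorem ladderFun_rung_le {x y : ℝ} (hx1 : 1 ≤ x) (hy : |y| ≤ sFun k x) : P.ladderFun x y ≤ P.ladderFun x 0 := by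
  -- antitone on `[0, s]`
  have hanti : AntitoneOn (fun y => P.ladderFun x y) (Icc 0 (sFun k x)) :=
    antitoneOn_of_deriv_nonpos (convex_Icc _ _)
      (fun y _ => (P.hasDerivAt_ladderFun_y x y).continuousAt.continuousWithinAt)
      (fun y _ => (P.hasDerivAt_ladderFun_y x y).differentiableAt.differentiableWithinAt)
      fun y hy => by
        rw [(P.hasDerivAt_ladderFun_y x y).deriv]
        exact P.dY_nonpos_rung hx1 (interior_subset hy)
  rcases le_or_gt 0 y with h | h
  · rw [abs_of_nonneg h] at hy
    exact hanti ⟨le_rfl, sFun_nonneg k x⟩ ⟨h, hy⟩ h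
  · rw [abs_of_neg h] at hy
    rw [← P.ladderFun_neg x y]
    exact hanti ⟨le_rfl, sFun_nonneg k x⟩ ⟨by linarith, hy⟩ (by linarith)

/-- `t₀ ≤ 1 + τ/6`, hence `τ t₀ < 1/8`. [folklore] -/
theorem τ_mul_t₀_lt : P.τ * P.t₀ < 1 / 8 := by
  have hτ := P.τ_pos
  have hτ1 := P.τ_le
  have ht := P.t₀_pos
  have ht1 : P.t₀ ≤ 1 + P.τ / 6 := by
    by_contra h
    have h1 : 1 ≤ P.t₀ := by linarith
    have := le_deriv_barrier h1
    rw [P.deriv_barrier_t₀] at this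
    linarith
  nlinarith

/-- **The axis of the cap lies in `{q₀ ≤ 0}`**: `q₀(x, 0) ≤ τ t₀ - c' < 0` for `-t₀ ≤ x ≤ 0`.
[folklore] -/
theorem core_axis_cap_le {x : ℝ} (hx : x ∈ Icc (-P.t₀) 0) : P.core (pt x 0) < 0 := by
  have hk0 : (0 : ℝ) ≤ k := Nat.cast_nonneg k
  have hoff : ∀ i < k, 1 / 2 ≤ |(pt x 0 : 𝔼 2) 0 - slabCtr i| := fun i _ => by
    rw [pt_apply_zero]; unfold slabCtr
    have hi0 : (0 : ℝ) ≤ i := Nat.cast_nonneg i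
    rw [abs_of_neg (by linarith [hx.2])]; linarith [hx.2]
  rw [P.core_eq_ladder_of_off hoff, ladder_pt, ladderFun_zero, sFun_of_nonpos hx.2,
    barrier_of_nonpos (by unfold xR; linarith [hx.2] : x - xR k ≤ 0)]
  -- `p(-x) ≤ p(t₀) ≤ τ t₀`
  have hmono : Monotone barrier := monotone_of_deriv_nonneg
    (contDiff_barrier.differentiable (by simp)) deriv_barrier_nonneg
  have h1 : barrier (-x) ≤ barrier P.t₀ := hmono (by linarith [hx.1])
  have h2 := P.barrier_t₀_le
  have h3 := P.τ_mul_t₀_lt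
  have h4 := P.coreLevel_gt
  have h5 := P.κ_smoothAbs_zero_mem.1
  have hτ := P.τ_pos
  nlinarith [hx.1, hx.2]

/-- **The lower floor lies in `{q₀ ≤ 0}`**: for `0 ≤ x ≤ x_R`, `q₀(x, -s(x)) ≤ τ x - c' < 0` (the
cut-off vanishes there or no slab is near). [folklore] -/
theorem core_lower_floor_lt {x : ℝ} (hx : x ∈ Icc 0 (xR k)) : P.core (pt x (-sFun k x)) < 0 := by
  have hτR := P.τ_mul_xR_le
  have hc := P.coreLevel_gt
  have hτ := P.τ_pos
  have hfl := P.ladderFun_floor_le' hx.1 hx.2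
  have hzero : 4 * cutoffY (-sFun k x) * slabBump k x = 0 := by
    rcases le_or_gt 1 x with h1 | h1
    · -- `s ≥ 1/2`, so `Γ(-s) = 0`
      have hs2 : 1 - 2 * bump 0 ≤ sFun k x ^ 2 := uMin_le_sFun_sq h1
      have hs0 := sFun_nonneg k x
      have : 1 / 4 < sFun k x ^ 2 := by linarith [bump_zero_lt]
      have hs : 1 / 2 < sFun k x := by nlinarith
      rw [cutoffY_of_le (by linarith)]; ring
    · -- no slab near the ramp
      rw [slabBump_eq_zero fun i _ => ?_]; · ring
      unfold slabCtr
      have hi0 : (0 : ℝ) ≤ i := Nat.cast_nonneg i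
      rw [abs_of_neg (by linarith)]; linarith
  unfold core coreFun
  simp only [pt_apply_zero, pt_apply_one]
  rw [hzero]
  have : P.τ * x ≤ P.τ * xR k := by gcongr; exact hx.2
  linarith

/-- **The upper floor right of a pocket lies in `{q₀ ≤ 0}`**: for `x ∈ [slabCtr i - z₁/2, x_R]`
left of the next slab, `q₀(x, s(x)) ≤ τ x + 4 b(z₁) - c' < 0`. [folklore] -/
theorem core_upper_floor_lt {i : ℕ} (hi : i < k) {x : ℝ} (hx : x ∈ Icc (slabCtr i - P.z₁ / 2) (xR k))
    (hnext : x ≤ slabCtr i + 7 / 2) : P.core (pt x (sFun k x)) < 0 := by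
  have hτR := P.τ_mul_xR_le
  have hc := P.coreLevel_gt
  have hτ := P.τ_pos
  have hτ1 := P.τ_le
  have hz := P.z₁_mem
  have hi0 : (0 : ℝ) ≤ i := Nat.cast_nonneg i
  have hx0 : 0 ≤ x := by unfold slabCtr at hx; linarith [hx.1, hz.2, xStar_pos]
  have hfl := P.ladderFun_floor_le hx0 hx.2
  have h4 := P.four_bump_z₁_le
  -- the slab sum is at most `b(z₁)`
  have hB : slabBump k x ≤ bump P.z₁ := by
    rcases lt_or_ge x (slabCtr i + 1 / 2) with h1 | h1
    · have hxs : |x - slabCtr i| < 1 / 2 := by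
        rw [abs_lt]; constructor <;> linarith [hx.1, hz.1, hz.2, xStar_pos]
      rw [slabBump_eq_of_abs_lt hi hxs]
      refine bump_le_bump ?_
      rw [abs_of_neg (by linarith [hz.2, xStar_pos] : P.z₁ < 0), abs_of_nonneg (by linarith [hx.1, hz.2, xStar_pos])]
      linarith [hx.1]
    · rw [slabBump_eq_zero fun j _ => ?_]
      · exact bump_nonneg _
      unfold slabCtr at *
      rcases le_or_gt j i with hji | hji
      · have : (j : ℝ) ≤ i := by exact_mod_cast hji
        rw [abs_of_nonneg (by linarith)]; linarith
      · have : (i : ℝ) + 1 ≤ j := by exact_mod_cast hji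
        rw [abs_of_neg (by linarith)]; linarith
  have hΓ := cutoffY_le_one (sFun k x)
  have hΓ0 := cutoffY_nonneg (sFun k x)
  have hB0 := slabBump_nonneg k x
  unfold core coreFun
  simp only [pt_apply_zero, pt_apply_one]
  have : P.τ * x ≤ P.τ * xR k := by gcongr; exact hx.2
  have : 4 * cutoffY (sFun k x) * slabBump k x ≤ 4 * bump P.z₁ := by nlinarith
  nlinarith

/-- **A rung lies in `{q₀ ≤ 0}`**: at `x = ctr i + x₂`, for `|y| ≤ s(x)`. [folklore] -/
theorem core_rung_lt {i : ℕ} (hi : i < k) {y : ℝ} (hy : |y| ≤ sFun k (ctr i + P.x₂)) :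
    P.core (pt (ctr i + P.x₂) y) < 0 := by
  obtain ⟨h1, h2, -⟩ := ctr_add_mem hi P.abs_x₂_lt
  have hoff : ∀ j < k, 1 / 2 ≤ |(pt (ctr i + P.x₂) y : 𝔼 2) 0 - slabCtr j| := fun j _ => by
    rw [pt_apply_zero]; exact half_le_abs_cell_sub_slabCtr P.abs_x₂_lt j i
  rw [P.core_eq_ladder_of_off hoff, ladder_pt]
  have hr := P.ladderFun_rung_le h1.le hy
  have hs := P.ladderFun_saddle_lt_coreLevel hi
  linarith

/-! #### The spine as a set, its connectedness, and the connectedness of `{q₀ ≤ 0}` -/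

/-- The abscissa of the `i`-th rung. [folklore] -/
def rungX (i : ℕ) : ℝ := ctr i + P.x₂

/-- The abscissa of the `i`-th pocket. [folklore] -/
def pocketX (i : ℕ) : ℝ := slabCtr i - P.z₁ / 2

/-- **The spine**: cap axis, lower floor, and for each hole the rung and the upper floor piece from
the pocket to the rung. [folklore] -/
def spine : Set (𝔼 2) :=
  ((fun x : ℝ => pt x 0) '' Icc (-P.t₀) 0 ∪ (fun x : ℝ => pt x (-sFun k x)) '' Icc 0 (xR k - 1)) ∪
    ⋃ i ∈ Finset.range k, ((fun y : ℝ => pt (P.rungX i) y) '' Icc (-sFun k (P.rungX i)) (sFun k (P.rungX i)) ∪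
      (fun x : ℝ => pt x (sFun k x)) '' Icc (P.pocketX i) (P.rungX i))

omit P in
/-- `x ↦ (x, g x)` is continuous for continuous `g`. [folklore] -/
theorem continuous_pt_graph {g : ℝ → ℝ} (hg : Continuous g) : Continuous fun x : ℝ => pt x (g x) := by
  have : Continuous fun x : ℝ => (WithLp.toLp 2 ![x, g x] : 𝔼 2) := by
    refine (PiLp.continuous_toLp 2 _).comp ?_
    refine continuous_pi fun i => ?_
    fin_cases i
    · exact continuous_id
    · exact hg
  exact this

omit P in
/-- `y ↦ (a, y)` is continuous. [folklore] -/
theorem continuous_pt_vert (a : ℝ) : Continuous fun y : ℝ => pt a y := by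
  have : Continuous fun y : ℝ => (WithLp.toLp 2 ![a, y] : 𝔼 2) := by
    refine (PiLp.continuous_toLp 2 _).comp ?_
    refine continuous_pi fun i => ?_
    fin_cases i
    · exact continuous_const
    · exact continuous_id
  exact this

/-- The pocket lies left of its rung, and the rung within `[0, x_R - 1]`. [folklore] -/
theorem pocketX_lt_rungX (i : ℕ) : P.pocketX i < P.rungX i ∧ 0 ≤ P.rungX i ∧ (i < k → P.rungX i ≤ xR k - 1) ∧
    P.rungX i ≤ slabCtr i + 7 / 2 := by
  have hz := P.z₁_mem
  have hx := P.x₂_mem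
  have hi0 : (0 : ℝ) ≤ i := Nat.cast_nonneg i
  unfold pocketX rungX slabCtr ctr xR
  refine ⟨by linarith [hz.1, hx.1], by linarith [hx.1], fun hi => ?_, by linarith [hx.2]⟩
  have hik : (i : ℝ) + 1 ≤ k := by exact_mod_cast hi
  linarith [hx.2]

/-- **The spine lies in `{q₀ ≤ 0}`.** [folklore] -/
theorem spine_subset : P.spine ⊆ P.core ⁻¹' Iic 0 := by
  have hk0 : (0 : ℝ) ≤ k := Nat.cast_nonneg k
  rintro p (⟨⟨x, hx, rfl⟩ | ⟨x, hx, rfl⟩⟩ | hp)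
  · exact (P.core_axis_cap_le hx).le
  · exact (P.core_lower_floor_lt ⟨hx.1, by unfold xR at hx ⊢; linarith [hx.2]⟩).le
  · obtain ⟨i, hi, hp⟩ := mem_iUnion₂.1 hp
    have hi' := Finset.mem_range.1 hi
    obtain ⟨h1, h2, h3, h4⟩ := P.pocketX_lt_rungX i
    rcases hp with ⟨y, hy, rfl⟩ | ⟨x, hx, rfl⟩
    · exact (P.core_rung_lt hi' (abs_le.2 ⟨hy.1, hy.2⟩)).le
    · refine (P.core_upper_floor_lt hi' ⟨hx.1, ?_⟩ (hx.2.trans h4)).le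
      linarith [hx.2, h3 hi']

/-- **The spine is preconnected.** [folklore] -/
theorem isPreconnected_spine : IsPreconnected P.spine := by
  have hs : Continuous (sFun k) := (contDiff_sFun k).continuous
  have hcA : Continuous fun x : ℝ => pt x 0 := continuous_pt_graph continuous_const
  have hcL : Continuous fun x : ℝ => pt x (-sFun k x) := continuous_pt_graph hs.neg
  have hcU : Continuous fun x : ℝ => pt x (sFun k x) := continuous_pt_graph hs
  -- the base `B = A ∪ L`, through `(0, 0)`
  set A : Set (𝔼 2) := (fun x : ℝ => pt x 0) '' Icc (-P.t₀) 0 with hA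
  set L : Set (𝔼 2) := (fun x : ℝ => pt x (-sFun k x)) '' Icc 0 (xR k - 1) with hL
  have hk0 : (0 : ℝ) ≤ k := Nat.cast_nonneg k
  have h0A : pt 0 0 ∈ A := ⟨0, ⟨by linarith [P.t₀_pos], le_rfl⟩, rfl⟩
  have h0L : pt 0 0 ∈ L := ⟨0, ⟨le_rfl, by unfold xR; linarith⟩, by simp [sFun_of_nonpos le_rfl]⟩
  have hB : IsPreconnected (A ∪ L) :=
    (isPreconnected_Icc.image _ hcA.continuousOn).union (pt 0 0) h0A h0L
      (isPreconnected_Icc.image _ hcL.continuousOn)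
  -- each hole contributes `T i = rung ∪ upper piece`, meeting the base at the foot of the rung
  set T : ℕ → Set (𝔼 2) := fun i =>
    (fun y : ℝ => pt (P.rungX i) y) '' Icc (-sFun k (P.rungX i)) (sFun k (P.rungX i)) ∪
      (fun x : ℝ => pt x (sFun k x)) '' Icc (P.pocketX i) (P.rungX i) with hT
  have hTconn : ∀ i, IsPreconnected (T i) := fun i => by
    have htop : pt (P.rungX i) (sFun k (P.rungX i)) ∈
        (fun y : ℝ => pt (P.rungX i) y) '' Icc (-sFun k (P.rungX i)) (sFun k (P.rungX i)) :=
      ⟨sFun k (P.rungX i), ⟨by linarith [sFun_nonneg k (P.rungX i)], le_rfl⟩, rfl⟩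
    have htop' : pt (P.rungX i) (sFun k (P.rungX i)) ∈
        (fun x : ℝ => pt x (sFun k x)) '' Icc (P.pocketX i) (P.rungX i) :=
      ⟨P.rungX i, ⟨(P.pocketX_lt_rungX i).1.le, le_rfl⟩, rfl⟩
    exact (isPreconnected_Icc.image _ (continuous_pt_vert _).continuousOn).union _ htop htop'
      (isPreconnected_Icc.image _ hcU.continuousOn)
  have hfoot : ∀ i < k, pt (P.rungX i) (-sFun k (P.rungX i)) ∈ (A ∪ L) ∩ T i := fun i hi => by
    obtain ⟨-, h2, h3, -⟩ := P.pocketX_lt_rungX i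
    refine ⟨Or.inr ⟨P.rungX i, ⟨h2, h3 hi⟩, rfl⟩, Or.inl ⟨-sFun k (P.rungX i), ⟨le_rfl, ?_⟩, rfl⟩⟩
    linarith [sFun_nonneg k (P.rungX i)]
  have hBT : ∀ i < k, IsPreconnected ((A ∪ L) ∪ T i) := fun i hi =>
    hB.union _ (hfoot i hi).1 (hfoot i hi).2 (hTconn i)
  -- the spine is the union of the family `{B} ∪ {B ∪ T i | i < k}`, all through `(0, 0)`
  have hrepr : P.spine = ⋃₀ ({A ∪ L} ∪ (fun i => (A ∪ L) ∪ T i) '' (Finset.range k : Set ℕ)) := by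
    unfold spine
    rw [← hA, ← hL]
    ext p
    simp only [mem_union, mem_iUnion, Finset.mem_range, exists_prop, hT, mem_sUnion, mem_insert_iff,
      mem_image, Finset.coe_range, mem_Iio, singleton_union]
    constructor
    · rintro (hp | ⟨i, hi, hp⟩)
      · exact ⟨A ∪ L, Or.inl rfl, hp⟩
      · exact ⟨(A ∪ L) ∪ T i, Or.inr ⟨i, hi, rfl⟩, Or.inr hp⟩
    · rintro ⟨t, rfl | ⟨i, hi, rfl⟩, hp⟩
      · exact Or.inl hp
      · rcases hp with hp | hp
        · exact Or.inl hp
        · exact Or.inr ⟨i, hi, hp⟩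
  rw [hrepr]
  refine isPreconnected_sUnion (pt 0 0) _ ?_ ?_
  · rintro t (rfl | ⟨i, -, rfl⟩)
    · exact Or.inl h0A
    · exact Or.inl (Or.inl h0A)
  · rintro t (rfl | ⟨i, hi, rfl⟩)
    · exact hB
    · exact hBT i (Finset.mem_range.1 (Finset.mem_coe.1 hi))

/-- The cap minimum and the pockets lie on the spine. [folklore] -/
theorem mem_spine : pt (-P.t₀) 0 ∈ P.spine ∧ ∀ i < k, pt (slabCtr i - P.z₁ / 2) 1 ∈ P.spine := by
  constructor
  · exact Or.inl (Or.inl ⟨-P.t₀, ⟨le_rfl, by linarith [P.t₀_pos]⟩, rfl⟩)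
  · intro i hi
    refine Or.inr (mem_iUnion₂.2 ⟨i, Finset.mem_range.2 hi, Or.inr ⟨P.pocketX i, ⟨le_rfl, (P.pocketX_lt_rungX i).1.le⟩, ?_⟩⟩)
    have hx := abs_cut_sub_slabCtr P.abs_z₁_lt i
    show pt (P.pocketX i) (sFun k (P.pocketX i)) = pt (slabCtr i - P.z₁ / 2) 1
    unfold pocketX
    rw [sFun_slab hi hx]

/-- **The critical points of index `0` of the core below `0` lie on the spine.** [folklore] -/
theorem criticalSetOfIndex_core_zero_inter_subset_spine :
    criticalSetOfIndex (𝓡 2) P.core 0 ∩ P.core ⁻¹' Iic 0 ⊆ P.spine := by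
  rw [criticalSetOfIndex_core_zero_inter]
  rintro p (rfl | ⟨i, hi, rfl⟩)
  · exact P.mem_spine.1
  · exact P.mem_spine.2 i (Finset.mem_range.1 (Finset.mem_coe.1 hi))

/-- `{q₀ ≤ 0}` is compact. [folklore] -/
theorem isCompact_core_preimage : IsCompact (P.core ⁻¹' Iic 0) := by
  refine Metric.isCompact_of_isClosed_isBounded (isClosed_Iic.preimage P.contDiff_core.continuous) ?_
  rw [isBounded_iff_forall_norm_le]
  set B := P.coreLevel + (3 / 2 * (xR k + 1) ^ 2 + 12) with hBdef
  refine ⟨|B| + 1, fun p hp => ?_⟩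
  have h1 : ‖p‖ ^ 2 ≤ B := by
    have := P.norm_sq_le_core p; have hp' : P.core p ≤ 0 := hp; rw [hBdef]; linarith
  nlinarith [norm_nonneg p, abs_nonneg B, le_abs_self B, sq_nonneg (‖p‖ - 1)]

/-- **The snake `{q₀ ≤ 0} ⊂ ℝ²` is connected.** [cite: Milnor1963, §3 and proof of Thm. 4.1] -/
theorem isConnected_core_preimage : IsConnected (P.core ⁻¹' Iic 0) :=
  isConnected_preimage_Iic_of_isCompact_of_subset (n := 1)
    ((contMDiff_iff_contDiff.2 P.contDiff_core).of_le (by norm_cast)) P.isCompact_core_preimage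
    P.isPreconnected_spine P.spine_subset P.criticalSetOfIndex_core_zero_inter_subset_spine
    ⟨pt (-P.t₀) 0, P.core_cap_lt.le⟩

end Params

end Ladder

end Literature.Topology.FourManifolds
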